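import Summits.QuantumFields.YangMills.Theorems.IR.TensionRatioPlaquetteFloorTorusPeel
import Mathlib.Analysis.Complex.Exponential
import HarnessLib

/-!
# Crux `IR` (stmt-QuantumFields-19354), line `tension-ratio`, input `PlaquetteFloorSC` — part 4:
# the strong-coupling expansion of the `π`-plaquette numerator to order `k`, uniformly in the volume

Pooled prover `ym-ir-line-pool-p3` (gen 3).  Helper module for item `stmt-QuantumFields-19354` (`--supports`; it closes
nothing).  Torus `(ℤ/L)⁴`, `L ≥ 2`, product Haar measure `dU`, unitary continuous action representation `ρ`, probe
representation `π`, observable `obs(U) = Re tr π(U_{p₀})`, `p₀ = (0; 0, 1)`.  Fix a finite set `A` of plaquettes containing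
`p₀` and every plaquette sharing a bond with `p₀` (blindness hypothesis `hA`), split the Wilson action `S = S_A + S_B` and put
`R(U) = e^{-β S_B(U)}` (which does not read the bonds of `p₀`).  With `k` the order of part 2 (all single-link integrals with
`< k` `ρ`-factors vanish):

* §1 every monomial `∫ obs · ∏ₐ cost(U, fₐ) · R dU` with a bond of `p₀` covered by fewer than `k` of the `fₐ` vanishes (part 3),
  hence all monomials of degree `j < k`, and all of degree `k` except `f ≡ p₀` (a plaquette containing the bonds `(0,0)` and
  `(0,1)` is `p₀`);
* §2 the surviving one factorises: `∫ obs · cost(p₀)^k · R = (∫_G Re tr π(h) (N − Re tr ρ(h))^k dh) · ∫ R`, and the group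
  integral equals `(−1)^k ∫_G Re tr π (Re tr ρ)^k` (lower binomial terms vanish below the order);
* (part 5, `…TorusNumerator`) sums these into the order-`k` bound on the numerator `∫ obs e^{−βS}`.

Everything is proved; no new definitions; nothing here bears on the Yang–Mills mass gap.
-/

set_option autoImplicit false

noncomputable section

open MeasureTheory Finset Function
open Literature.MathematicalPhysics.QuantumFieldTheory
open Summit.QuantumFields.YangMills.Cruxes.IR.SCFloor (mem_pedges plaquetteHolonomy_update_of_not_mem
  integral_pi_eq_integral_integral_update integral_update_plaquetteHolonomy)

namespace Summit.QuantumFields.YangMills.Cruxes.IR.TensionRatio.PlaquetteFloor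

variable {L : ℕ} {G : Type*} [Group G] [TopologicalSpace G] [IsTopologicalGroup G] [CompactSpace G]
  [MeasurableSpace G] [BorelSpace G] [SecondCountableTopology G] {m N : ℕ}
  (π : G →* Matrix (Fin m) (Fin m) ℂ) (ρ : G →* Matrix (Fin N) (Fin N) ℂ)

/-! ## §0 Plaquette costs: sign, size, measurability; the Taylor remainder of `e^{-t}` -/

omit [TopologicalSpace G] [IsTopologicalGroup G] [CompactSpace G] [MeasurableSpace G] [BorelSpace G]
  [SecondCountableTopology G] in
/-- `0 ≤ N − Re tr ρ(h) ≤ 2N` for unitary `ρ`. -/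
theorem re_trace_bounds (hρu : ∀ g, ρ g ∈ Matrix.unitaryGroup (Fin N) ℂ) (h : G) :
    0 ≤ (N : ℝ) - (ρ h).trace.re ∧ (N : ℝ) - (ρ h).trace.re ≤ 2 * N := by
  have hb : |(ρ h).trace.re| ≤ N := by
    calc |(ρ h).trace.re| ≤ ‖(ρ h).trace‖ := Complex.abs_re_le_norm _
      _ = ‖∑ i, ρ h i i‖ := rfl
      _ ≤ ∑ i, ‖ρ h i i‖ := norm_sum_le _ _
      _ ≤ ∑ _i : Fin N, (1 : ℝ) := Finset.sum_le_sum fun i _ => entry_norm_bound_of_unitary (hρu h) i i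
      _ = N := by simp
  constructor <;> cases abs_le.1 hb <;> linarith

omit [TopologicalSpace G] [IsTopologicalGroup G] [CompactSpace G] [MeasurableSpace G] [BorelSpace G]
  [SecondCountableTopology G] in
/-- `0 ≤ cost ≤ 2N` for unitary `ρ`. -/
theorem plaquetteCost_bounds [NeZero L] (hρu : ∀ g, ρ g ∈ Matrix.unitaryGroup (Fin N) ℂ) (U : GaugeConfig 4 L G)
    (q : Plaquette 4 L) : 0 ≤ plaquetteCost ρ U q ∧ plaquetteCost ρ U q ≤ 2 * N :=
  re_trace_bounds ρ hρu _

omit [CompactSpace G] in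
/-- Plaquette costs are measurable (continuous `ρ`, second-countable `G`). -/
theorem measurable_plaquetteCost' [NeZero L] (hρ : Continuous ρ) (q : Plaquette 4 L) :
    Measurable fun U : GaugeConfig 4 L G => plaquetteCost ρ U q := by
  unfold plaquetteCost
  exact measurable_const.sub ((Complex.continuous_re.comp hρ.matrix_trace).measurable.comp
    (measurable_plaquetteHolonomy _ _ _))

/-- **Taylor remainder of `e^{-t}`**: for `0 ≤ t ≤ 1`,
`|e^{-t} − ∑_{j ≤ k} (−t)^j/j!| ≤ 2 t^{k+1}`. -/
theorem abs_exp_neg_sub_sum_le {t : ℝ} (ht0 : 0 ≤ t) (ht1 : t ≤ 1) (k : ℕ) :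
    |Real.exp (-t) - ∑ j ∈ Finset.range (k + 1), (-t) ^ j / (j.factorial : ℝ)| ≤ 2 * t ^ (k + 1) := by
  have h := Real.exp_bound (x := -t) (by rw [abs_neg, abs_of_nonneg ht0]; exact ht1) (n := k + 1) (Nat.succ_pos k)
  rw [abs_neg, abs_of_nonneg ht0] at h
  refine h.trans ?_
  rw [mul_comm]
  refine mul_le_mul_of_nonneg_right ?_ (pow_nonneg ht0 _)
  rw [div_le_iff₀ (by positivity)]
  have hf : (1 : ℝ) ≤ (k + 1).factorial := by exact_mod_cast Nat.one_le_iff_ne_zero.2 (Nat.factorial_ne_zero _)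
  have : ((k + 1).succ : ℝ) = (k : ℝ) + 2 := by push_cast; ring
  rw [this]
  push_cast
  nlinarith

/-! ## §1 Monomials covering a bond of `p₀` fewer than `k` times vanish -/

section Monomials

variable [NeZero L] [Fact (1 < L)]

/-- **Vanishing monomials.**  For plaquettes `f₁,…,fⱼ`, a bond `ℓ` of `p₀ = (0;0,1)` lying in fewer than `k` of them, and a
set `A` of plaquettes outside which no plaquette reads a bond of `p₀`:
`∫ Re tr π(U_{p₀}) · ∏ₐ cost(U, fₐ) · e^{−β ∑_{q ∉ A} cost(U,q)} dU = 0`. -/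
theorem integral_obs_prod_cost_eq_zero (hπ : Continuous π) (hρ : Continuous ρ)
    (hρu : ∀ g, ρ g ∈ Matrix.unitaryGroup (Fin N) ℂ) {k : ℕ}
    (hV : ∀ n < k, ∀ (K : Matrix (Fin m) (Fin m) ℂ) (M : Fin n → Matrix (Fin N) (Fin N) ℂ),
      ∫ g, (π g * K).trace.re * ∏ i, (ρ g * M i).trace.re ∂haarProbability G = 0)
    (A : Finset (Plaquette 4 L))
    (hA : ∀ q ∉ A, ∀ e ∈ ({((0 : Site 4 L), (0 : Fin 4)), ((0 : Site 4 L).shift 0, (1 : Fin 4)),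
        ((0 : Site 4 L).shift 1, (0 : Fin 4)), ((0 : Site 4 L), (1 : Fin 4))} : Finset (Edge 4 L)),
      e ∉ ({(q.1, q.2.1.1), (q.1.shift q.2.1.1, q.2.1.2), (q.1.shift q.2.1.2, q.2.1.1), (q.1, q.2.1.2)} : Finset (Edge 4 L)))
    {β : ℝ} (hβ : 0 ≤ β) {j : ℕ} (f : Fin j → Plaquette 4 L) {ℓ : Edge 4 L}
    (hℓ : ℓ ∈ ({((0 : Site 4 L), (0 : Fin 4)), ((0 : Site 4 L).shift 0, (1 : Fin 4)),
        ((0 : Site 4 L).shift 1, (0 : Fin 4)), ((0 : Site 4 L), (1 : Fin 4))} : Finset (Edge 4 L)))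
    (hcard : (Finset.univ.filter fun a : Fin j =>
        ℓ ∈ ({((f a).1, (f a).2.1.1), ((f a).1.shift (f a).2.1.1, (f a).2.1.2), ((f a).1.shift (f a).2.1.2, (f a).2.1.1),
          ((f a).1, (f a).2.1.2)} : Finset (Edge 4 L))).card < k) :
    ∫ U, (π (plaquetteHolonomy U 0 0 1)).trace.re * (∏ a, plaquetteCost ρ U (f a)) *
        Real.exp (-β * ∑ q ∈ Aᶜ, plaquetteCost ρ U q) ∂(Measure.pi fun _ : Edge 4 L => haarProbability G) = 0 := by
  classical
  refine integral_obs_prod_eq_zero π ρ hπ hρ hρu hV 0 (i := 0) (j := 1) (by decide) hℓ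
    (fun a U => plaquetteCost ρ U (f a)) _ hcard (fun a => measurable_plaquetteCost' ρ hρ (f a)) (Cψ := 2 * N)
    (fun a U => ?_) (fun a ha U => ?_) (fun a ha U g => ?_) _ ?_ (CR := 1) (fun U => ?_) (fun U g => ?_)
  · rw [abs_of_nonneg (plaquetteCost_bounds ρ hρu U (f a)).1]; exact (plaquetteCost_bounds ρ hρu U (f a)).2
  · exact exists_plaquetteCost_update ρ (f a) U (Finset.mem_filter.1 ha).2
  · exact plaquetteCost_update_of_not_mem ρ (f a) U (fun h => ha (Finset.mem_filter.2 ⟨Finset.mem_univ _, h⟩)) g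
  · exact (Real.measurable_exp.comp ((Finset.measurable_sum _ fun q _ => measurable_plaquetteCost' ρ hρ q).const_mul _))
  · rw [abs_of_nonneg (Real.exp_pos _).le, Real.exp_le_one_iff, neg_mul, neg_nonpos]
    exact mul_nonneg hβ (Finset.sum_nonneg fun q _ => (plaquetteCost_bounds ρ hρu U q).1)
  · congr 2
    exact Finset.sum_congr rfl fun q hq => plaquetteCost_update_of_not_mem ρ q U (hA q (Finset.mem_compl.1 hq) ℓ hℓ) g

/-- Degree `j < k`: every monomial vanishes (the bond `(0,0)` is covered at most `j` times). -/
theorem integral_obs_prod_cost_eq_zero_of_lt (hπ : Continuous π) (hρ : Continuous ρ)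
    (hρu : ∀ g, ρ g ∈ Matrix.unitaryGroup (Fin N) ℂ) {k : ℕ}
    (hV : ∀ n < k, ∀ (K : Matrix (Fin m) (Fin m) ℂ) (M : Fin n → Matrix (Fin N) (Fin N) ℂ),
      ∫ g, (π g * K).trace.re * ∏ i, (ρ g * M i).trace.re ∂haarProbability G = 0)
    (A : Finset (Plaquette 4 L))
    (hA : ∀ q ∉ A, ∀ e ∈ ({((0 : Site 4 L), (0 : Fin 4)), ((0 : Site 4 L).shift 0, (1 : Fin 4)),
        ((0 : Site 4 L).shift 1, (0 : Fin 4)), ((0 : Site 4 L), (1 : Fin 4))} : Finset (Edge 4 L)),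
      e ∉ ({(q.1, q.2.1.1), (q.1.shift q.2.1.1, q.2.1.2), (q.1.shift q.2.1.2, q.2.1.1), (q.1, q.2.1.2)} : Finset (Edge 4 L)))
    {β : ℝ} (hβ : 0 ≤ β) {j : ℕ} (hj : j < k) (f : Fin j → Plaquette 4 L) :
    ∫ U, (π (plaquetteHolonomy U 0 0 1)).trace.re * (∏ a, plaquetteCost ρ U (f a)) *
        Real.exp (-β * ∑ q ∈ Aᶜ, plaquetteCost ρ U q) ∂(Measure.pi fun _ : Edge 4 L => haarProbability G) = 0 := by
  classical
  refine integral_obs_prod_cost_eq_zero π ρ hπ hρ hρu hV A hA hβ f (ℓ := ((0 : Site 4 L), (0 : Fin 4))) (by simp) ?_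
  exact lt_of_le_of_lt ((Finset.card_filter_le _ _).trans (by rw [Finset.card_univ, Fintype.card_fin])) hj

/-- Degree `k`, not the pure power of `cost(p₀)`: the monomial vanishes (some `fₐ ≠ p₀` misses the bond `(0,0)` or the bond
`(0,1)` of `p₀`, which is then covered at most `k − 1` times). -/
theorem integral_obs_prod_cost_eq_zero_of_ne (hπ : Continuous π) (hρ : Continuous ρ)
    (hρu : ∀ g, ρ g ∈ Matrix.unitaryGroup (Fin N) ℂ) {k : ℕ}
    (hV : ∀ n < k, ∀ (K : Matrix (Fin m) (Fin m) ℂ) (M : Fin n → Matrix (Fin N) (Fin N) ℂ),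
      ∫ g, (π g * K).trace.re * ∏ i, (ρ g * M i).trace.re ∂haarProbability G = 0)
    (A : Finset (Plaquette 4 L))
    (hA : ∀ q ∉ A, ∀ e ∈ ({((0 : Site 4 L), (0 : Fin 4)), ((0 : Site 4 L).shift 0, (1 : Fin 4)),
        ((0 : Site 4 L).shift 1, (0 : Fin 4)), ((0 : Site 4 L), (1 : Fin 4))} : Finset (Edge 4 L)),
      e ∉ ({(q.1, q.2.1.1), (q.1.shift q.2.1.1, q.2.1.2), (q.1.shift q.2.1.2, q.2.1.1), (q.1, q.2.1.2)} : Finset (Edge 4 L)))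
    {β : ℝ} (hβ : 0 ≤ β) (f : Fin k → Plaquette 4 L)
    (hf : f ≠ fun _ => ((0 : Site 4 L), ⟨((0 : Fin 4), (1 : Fin 4)), Fin.zero_lt_one⟩)) :
    ∫ U, (π (plaquetteHolonomy U 0 0 1)).trace.re * (∏ a, plaquetteCost ρ U (f a)) *
        Real.exp (-β * ∑ q ∈ Aᶜ, plaquetteCost ρ U q) ∂(Measure.pi fun _ : Edge 4 L => haarProbability G) = 0 := by
  classical
  obtain ⟨a₀, ha₀⟩ : ∃ a, f a ≠ ((0 : Site 4 L), ⟨((0 : Fin 4), (1 : Fin 4)), Fin.zero_lt_one⟩) := by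
    by_contra h
    push Not at h
    exact hf (funext h)
  -- one of the two bonds `(0,0)`, `(0,1)` is not a bond of `f a₀`
  have hmiss : ∃ ℓ ∈ ({((0 : Site 4 L), (0 : Fin 4)), ((0 : Site 4 L).shift 0, (1 : Fin 4)),
        ((0 : Site 4 L).shift 1, (0 : Fin 4)), ((0 : Site 4 L), (1 : Fin 4))} : Finset (Edge 4 L)),
      ℓ ∉ ({((f a₀).1, (f a₀).2.1.1), ((f a₀).1.shift (f a₀).2.1.1, (f a₀).2.1.2),
        ((f a₀).1.shift (f a₀).2.1.2, (f a₀).2.1.1), ((f a₀).1, (f a₀).2.1.2)} : Finset (Edge 4 L)) := by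
    by_contra h
    push Not at h
    have h0 := h ((0 : Site 4 L), (0 : Fin 4)) (by simp)
    have h1 := h ((0 : Site 4 L), (1 : Fin 4)) (by simp)
    obtain ⟨hy, hi, hj⟩ := eq_of_mem_pedges_of_mem_pedges (f a₀).2.2 h0 h1
    exact ha₀ (Prod.ext hy (Subtype.ext (Prod.ext hi hj)))
  obtain ⟨ℓ, hℓ, hℓa⟩ := hmiss
  refine integral_obs_prod_cost_eq_zero π ρ hπ hρ hρu hV A hA hβ f hℓ ?_
  calc (Finset.univ.filter fun a : Fin k => ℓ ∈ ({((f a).1, (f a).2.1.1), ((f a).1.shift (f a).2.1.1, (f a).2.1.2),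
          ((f a).1.shift (f a).2.1.2, (f a).2.1.1), ((f a).1, (f a).2.1.2)} : Finset (Edge 4 L))).card
      < (Finset.univ : Finset (Fin k)).card :=
        Finset.card_lt_card ((Finset.filter_ssubset).2 ⟨a₀, Finset.mem_univ _, hℓa⟩)
    _ = k := by rw [Finset.card_univ, Fintype.card_fin]

/-! ## §2 The surviving monomial factorises through the group -/

/-- **The pure power of `cost(p₀)` factorises**:
`∫ obs · cost(p₀)^k · R dU = (∫_G Re tr π(h) (N − Re tr ρ(h))^k dh) · ∫ R dU` for every `(0,0)`-blind bounded weight `R`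
(integrating the bond `(0,0)` makes `U_{p₀}` Haar distributed). -/
theorem integral_obs_cost_pow_mul_eq (hπ : Continuous π) (hρ : Continuous ρ)
    (hρu : ∀ g, ρ g ∈ Matrix.unitaryGroup (Fin N) ℂ) (k : ℕ)
    (R : GaugeConfig 4 L G → ℝ) (hRm : Measurable R) {CR : ℝ} (hRb : ∀ U, |R U| ≤ CR)
    (hR : ∀ (U : GaugeConfig 4 L G) (g : G), R (update U ((0 : Site 4 L), (0 : Fin 4)) g) = R U) :
    ∫ U, (π (plaquetteHolonomy U 0 0 1)).trace.re *
        (plaquetteCost ρ U ((0 : Site 4 L), ⟨((0 : Fin 4), (1 : Fin 4)), Fin.zero_lt_one⟩)) ^ k * R U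
        ∂(Measure.pi fun _ : Edge 4 L => haarProbability G) =
      (∫ h, (π h).trace.re * ((N : ℝ) - (ρ h).trace.re) ^ k ∂haarProbability G) *
        ∫ U, R U ∂(Measure.pi fun _ : Edge 4 L => haarProbability G) := by
  classical
  obtain ⟨Cπ, hCπ⟩ : ∃ C : ℝ, ∀ h : G, |(π h).trace.re| ≤ C := by
    obtain ⟨C, hC⟩ := isCompact_univ.exists_bound_of_continuousOn
      (Complex.continuous_re.comp hπ.matrix_trace).continuousOn
    exact ⟨C, fun h => Real.norm_eq_abs _ ▸ hC h (Set.mem_univ h)⟩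
  have hCπ0 : 0 ≤ Cπ := le_trans (abs_nonneg _) (hCπ 1)
  set Ψ : G → ℝ := fun h => (π h).trace.re * ((N : ℝ) - (ρ h).trace.re) ^ k with hΨ
  set Φ : GaugeConfig 4 L G → ℝ := fun U => Ψ (plaquetteHolonomy U 0 0 1) * R U with hΦ
  have hΨc : Continuous Ψ := (Complex.continuous_re.comp hπ.matrix_trace).mul
    ((continuous_const.sub (Complex.continuous_re.comp hρ.matrix_trace)).pow k)
  have hobs : ∀ U : GaugeConfig 4 L G, (π (plaquetteHolonomy U 0 0 1)).trace.re *
      (plaquetteCost ρ U ((0 : Site 4 L), ⟨((0 : Fin 4), (1 : Fin 4)), Fin.zero_lt_one⟩)) ^ k * R U = Φ U := fun U => by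
    simp only [hΦ, hΨ, plaquetteCost]
  simp_rw [hobs]
  have hΦm : Measurable Φ := (hΨc.measurable.comp (measurable_plaquetteHolonomy _ _ _)).mul hRm
  have hΦb : ∀ U, |Φ U| ≤ Cπ * (2 * N) ^ k * max CR 0 := fun U => by
    simp only [hΦ, hΨ]
    rw [abs_mul, abs_mul, abs_pow]
    have h2 := re_trace_bounds ρ hρu (plaquetteHolonomy U 0 0 1)
    refine mul_le_mul (mul_le_mul (hCπ _) ?_ (by positivity) hCπ0) ((hRb U).trans (le_max_left _ _)) (abs_nonneg _)
      (mul_nonneg hCπ0 (by positivity))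
    rw [abs_of_nonneg h2.1]
    exact pow_le_pow_left₀ h2.1 h2.2 k
  rw [integral_pi_eq_integral_integral_update ((0 : Site 4 L), (0 : Fin 4)) hΦm hΦb]
  have hinner : ∀ U : GaugeConfig 4 L G,
      ∫ g, Φ (update U ((0 : Site 4 L), (0 : Fin 4)) g) ∂haarProbability G = (∫ h, Ψ h ∂haarProbability G) * R U := by
    intro U
    simp only [hΦ, hR]
    rw [integral_mul_const]
    congr 1
    exact integral_update_plaquetteHolonomy Ψ (0 : Site 4 L) (i := 0) (j := 1) (by decide) U (by simp)
  simp_rw [hinner]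
  rw [integral_const_mul]

omit [SecondCountableTopology G] in
/-- **The group integral**: below the order the binomial cross terms vanish, so
`∫ Re tr π(h) (N − Re tr ρ(h))^k dh = (−1)^k ∫ Re tr π(h) (Re tr ρ(h))^k dh`. -/
theorem integral_re_trace_mul_sub_pow (hπ : Continuous π) (hρ : Continuous ρ) {k : ℕ}
    (hV : ∀ n < k, ∀ (K : Matrix (Fin m) (Fin m) ℂ) (M : Fin n → Matrix (Fin N) (Fin N) ℂ),
      ∫ g, (π g * K).trace.re * ∏ i, (ρ g * M i).trace.re ∂haarProbability G = 0) :
    ∫ h, (π h).trace.re * ((N : ℝ) - (ρ h).trace.re) ^ k ∂haarProbability G =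
      (-1) ^ k * ∫ h, (π h).trace.re * ((ρ h).trace.re) ^ k ∂haarProbability G := by
  -- pure powers below the order vanish
  have hvan : ∀ n < k, ∫ h, (π h).trace.re * ((ρ h).trace.re) ^ n ∂haarProbability G = 0 := by
    intro n hn
    have := hV n hn 1 (fun _ => 1)
    simpa only [Matrix.mul_one, Finset.prod_const, Finset.card_univ, Fintype.card_fin] using this
  -- binomial expansion
  have hexp : ∀ h : G, (π h).trace.re * ((N : ℝ) - (ρ h).trace.re) ^ k =
      ∑ n ∈ Finset.range (k + 1), ((-1) ^ n * (N : ℝ) ^ (k - n) * (k.choose n : ℝ)) *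
        ((π h).trace.re * ((ρ h).trace.re) ^ n) := by
    intro h
    rw [sub_eq_neg_add, add_pow, Finset.mul_sum]
    refine Finset.sum_congr rfl fun n _ => ?_
    rw [neg_pow]
    ring
  simp_rw [hexp]
  have hint : ∀ n : ℕ, Integrable (fun h => ((-1) ^ n * (N : ℝ) ^ (k - n) * (k.choose n : ℝ)) *
      ((π h).trace.re * ((ρ h).trace.re) ^ n)) (haarProbability G) := fun n =>
    YM2.integrable_of_continuous (continuous_const.mul ((Complex.continuous_re.comp hπ.matrix_trace).mul
      ((Complex.continuous_re.comp hρ.matrix_trace).pow n)))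
  rw [integral_finsetSum _ fun n _ => hint n, Finset.sum_range_succ, Finset.sum_eq_zero fun n hn => ?_]
  · rw [integral_const_mul, Nat.choose_self, Nat.sub_self, pow_zero]
    push_cast
    ring
  · rw [integral_const_mul, hvan n (Finset.mem_range.1 hn), mul_zero]

end Monomials

end Summit.QuantumFields.YangMills.Cruxes.IR.TensionRatio.PlaquetteFloor

end
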